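import Mathlib
import HarnessLib
import Summits.AtomisticToContinuum.Crystallization.Theorems.ChartedPlanarOrderDoorDischarged
import Summits.AtomisticToContinuum.Crystallization.Theorems.OverbindingBudgetLiouvilleDictionary
import Summits.AtomisticToContinuum.Crystallization.Theorems.ChartedPlanarOrderDoorLayeredExactness
import Summits.AtomisticToContinuum.Crystallization.Theorems.ChartedPlanarOrderDoorLayeredBridge
import Literature.Geometry.DiscreteGeometry.TwoShellPatterns

/-!
# «HomCoercivityBD» — HBG♮(u) in the bounded-distortion currency OF RECORD (lens-4's tree `NearHomBD`), its certificate face, the robust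
reduction, and the NON-VACUITY KERNELS (w1)(w2)
(decomp-a2c lens-2 «structural dichotomy (special vs generic)», generation 23, second deliverable — v8 = generation 24: bridge B DISCHARGED by the
landed tree theorem `…ChartedPlanarOrderDoorLayeredBridge.layeredHom_of_twoPeriodic` (lens-3 g22, hand-2 p820697) ⇒ `periodicChart_of_bridgeB`,
★♭′ `gap_and_pert_1_50_of_exactLayered'` bridge-free; namespace = module path `…Theorems.ChartedZeroExcessLayeredHomCoercivityBD` (critic row 433
caveat; supersedes v7 a8326eb9); critic ORDER row 393 (3) «HBG♮(u) FIRST»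
and ★ row 399 = ERRATUM OF RECORD + RULINGS: (2) CURRENCY «tree definition = lens-4's landed `OverbindingBudgetLiouvilleDictionary.NearHomBD Λ`
(`L : E3 ≃L E3`, `‖L‖ ≤ Λ ∧ ‖L⁻¹‖ ≤ Λ`), Λ₀ = 2; lens-2's `IsBDChart` must NOT become a second tree definition»; (5) «proceed NOW with
HBG♮(u) in BD currency, shipping (w1)(w2) and ONE extra must-fail probe "HBG♮(u)_BD ↚ BULK-free tautology"; then `bulkDoor_of_homBD :
DoorHomogeneityBD 2 → HBG♮(u)_BD → BulkDefectGapDoor` re-proved over the BD currency restores the third N branch»; STANDING RULE NV)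

## Currency (row 399 (2)) — this file IMPORTS lens-4's tree definition and defines NO nearness predicate of its own; v7 REBASE (row 411 (3)):
## it also IMPORTS the tree modules `…ChartedPlanarOrderDoorLayered{Exact,Near,∅,Exactness}` and re-declares NONE of their items
`NearHomBD Λ τ r S Q` (tree, `Theorems/OverbindingBudgetLiouvilleDictionary.lean` §3): ONE continuous linear automorphism `L` of distortion
`≤ Λ`, ONE offset profile `w : ℤ → E3`, an injective assignment `Ψ : Q → LayeredHom L w` with `(τ, r)`-close two-sidedly matched environments.
The vacuity of the unbounded `NearHom` (lens-4 g28 `nearHom_of_countable`, `L = 0`) is what row 399 (1) records; `Λ` kills it at chunk level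
once the prover picks `r ≥ Λ`, `τ < Λ⁻¹` (tree `not_nearHomBD_singleton`).  The v1–v3 drafts of this node carried a private currency with a
separated reference and a coherent assignment; per row 399 (2) those clauses are NOT part of the statement currency — they reappear only
as the CONTENT of the robust reduction (§4 `GaugeReduction`: reference clean-up and local re-assignment are TRUE·S steps of its proof plan).

## The pieces (special = exactly layered ∣ generic = near-layered)
* HBG♮(u)[BD] `NearHomBulkGapDenseBD` — lens-3's HBG♮(u) with the tree's `NearHomBD Λ τ r` for `NearHom τ r`, `Λ ≥ 1` quantified FIRST, a slack `ε`
  (this node's g23 text; since v7 a TREE declaration, `…DoorLayered` §5 «interface with lens-2», imported — as are K0″, K2″ and ★ below).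
  K0″ `hbgBD_of_bulk : BulkDefectGap → HBG♮(u)[BD]` (WEAKER than BULK, PROVED);
  K2″ `bulkDoor_of_homBD : 1 ≤ Λ → DoorHomogeneityBD Λ → HBG♮(u)[BD] → BulkDefectGapDoor` (the HomCut seam RE-PROVED over the BD currency —
  row 399 (5) «restores the third N branch»);
  ★ `gap_and_pert_1_50_of_homBD : DoorHomogeneityBD 2 → HBG♮(u)[BD] → VisibleGap (1/50) ∧ PertRegime (1/50)` — door DISCHARGED BY NAME
  (`ChartedPlanarOrderDoorDischarged.gap_and_pert_1_50_of_bulkDoor_discharged`).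
* SPECIAL · A `LayeredCoercivityDense` — HBG♮(u)[BD] on EXACTLY layered configurations `S = LayeredHom L w` (BD chart): the coercivity-with-density
  of `e⋆` on {BD charts} × {offset profiles} = the CERTIFICATE FACE (census TAG 139′ HBC-CERT′ + REGISTRY column).
  `layeredCoercivityDense_of_hbgBD : HBG♮(u)[BD] → A` (A WEAKER, PROVED: an exact structure is near itself along `id`).
* A♭ `ExactLayeredBulkGap Λ` — A on ROOT WINDOWS of rooted, separated, everywhere-clean exactly layered BD structures, no slack (§3b):
  `exactLayeredBulkGap_of_layeredCoercivityDense : 1 ≤ Λ → A → A♭ Λ` (WEAKER, PROVED), `exactLayeredBulkGap_of_bulk` (K0♭); A♭ = lens-3's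
  HBG″♭ `PeriodicBulkGap` (DoorLayered §4) in EXTRINSIC form — HBG″♭(Λ) ⟸ A♭(Λ′) ∧ bridge B (lens-3 g23; critic row 407 (2)(4): «lens-2's best
  target is now HBG″♭ via A»).
* §3c (v6/v7, critic l.1957 ORDER «state N″ / its HBG-side twin HBG″♭ OVER TREE NAMES» + row 411 (2) «A♭ IS lens-2's typed half of HBG″♭»):
  over the TREE declarations HBG″♭ `PeriodicBulkGap Λ`, L1′♮ `DoorPeriodic Λ`, `TwoPeriodic` (all imported): the bridge interface B `PeriodicChart Λ Λ′`
  (rooted `δ`-separated two-periodic ⟹ `= LayeredHom L w` with `‖L‖, ‖L⁻¹‖ ≤ Λ′ δ`; PROVED by lens-3 g22 with `Λ′ δ = 4Λ + 13Λ/δ²`, HOME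
  `BridgeB.lean`, pending landing) and the kernels `exactLayeredBulkGap_of_periodicBulkGap : HBG″♭ Λ → A♭ Λ` (OUTRIGHT),
  `periodicBulkGap_of_exactLayered : B → (∀ δ, A♭ (Λ′ δ)) → HBG″♭ Λ`, `periodicBulkGap_of_layeredCoercivityDense : B → A → HBG″♭ Λ`,
  ★♭ `gap_and_pert_1_50_of_exactLayered : DoorPeriodic Λ → B → (∀ δ, A♭ (Λ′ δ)) → VisibleGap (1/50) ∧ PertRegime (1/50)` (the (β) column of
  record fed by lens-2's pieces, via tree `gap_and_pert_1_50_of_periodic'`); non-vacuity of B's hypotheses `periodicChart_hyps` (fcc: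
  `twoPeriodic_fcc`, `isSep_fcc`, `layered₁_eq_fcc`, §5.5).
* GENERIC · B `NearHomReduction := A → HBG♮(u)[BD]` (BRIDGE-SHAPED) and its ROBUST form through a continuous MISFIT GAUGE `mis L w y` (interface
  with a separate construction obligation D1): B₁ `GaugeCoercivity mis` (CERTIFICATE in gauge form; exact separated BD layered structures; no
  cleanliness, no `matchedAt`), B₂ `GaugeControlsMatching mis` (GEOMETRY, TRUE·M, edge-free), B₃ `SiteEnergyLocality` (CB-LOCALITY, TRUE·S/M),
  `GaugeReduction := (∃ mis, B₁ ∧ B₂) → B₃ → HBG♮(u)[BD]` (TRUE·M BOOKKEEPING incl. reference CLEAN-UP and LOCAL RE-ASSIGNMENT, see its docstring),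
  K3″ `hbgBD_of_gauge`, K1″ `hbgBD_of_pieces`, ★★ `gap_and_pert_1_50_of_gauge` (all PROVED compositions).
* NON-VACUITY (rule NV, KERNEL LEMMAS IN THIS FILE, §5):
  (w1) `not_nearHomBD_isolated` — an isolated atom is not `(2, τ, r)`-near-homogeneous (`r ≥ 2`, `τ < 1/2`; instance of the tree lemma);
  (w2) `not_nearHomBD_twoPatch` — the SCALE-INCOHERENT TWO-PATCH: two clean fcc patches at scales `1` and `9/10` (the two ends of the clean
       window) form a `9/10`-separated configuration `twoPatch` whose two centres are a CLEAN chunk (`isCleanChunk_twoPatch`), each centre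
       near-homogeneous ON ITS OWN (`nearHomBD_patch₁`, `nearHomBD_patch₂`, charts of distortion `≤ 2` constructed explicitly), while the
       two-atom chunk is NOT `(2, τ, r)`-near-homogeneous for `τ ≤ 1/50`, `r ≥ 2` — one chart cannot serve two scales (`‖p − (9/10)x‖ ≥ 1/10`
       on non-zero fcc vectors).  Packaged: `nearHomBD_genuine_restriction` = the extra must-fail probe of row 399 (5) in theorem form
       («`NearHomBD 2` is a GENUINE restriction on clean chunks; HBG♮(u)[BD] is not BULK with a dischargeable hypothesis»).
       (Orientation-incoherent patches would do as well; the scale version keeps the kernel proof inside `(1/√2)·D₃` arithmetic.)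
LEAF TAGS: A, B₁ CERTIFICATE-CLASS·INSTRUMENTABLE (TAG 139′ + REGISTRY; stable-sub-window caveat as TAG 138′, row 399 (4)); B₂ TRUE·M (needs D1);
B₃ TRUE·S/M·ATTACKABLE; GaugeReduction TRUE·M·ATTACKABLE; B (plain) superseded by the gauge form.  D1 (definition request, Summits side): the
Barlow misfit gauge `barlowMisfit L w y`.  DEDUP HOOK (row 399 (4)): the certificate A / B₁ is NOT `PhononStability` (stmt 9333: positive phonon
spectrum of ONE lattice); it is a statement about the ENERGY PER SITE of all BD LAYERED structures vs their unmatched / misfit density.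
WHY NOVEL (tree-relative): `lean search 'LayeredCoercivity|GaugeCoercivity|SiteEnergyLocality|twoPatch|NearHomBulkGapDenseBD'` → no hits
(2026-08-31); the tree has HBG (`HomogeneousBulkGap`, exact `HomStacking`), HBG♮/HBG♮(u) over the vacuous `NearHom`, and lens-4's currency
file with the singleton witness only.
-/

noncomputable section

open scoped BigOperators
open MeasureTheory Set Metric
open Summit.AtomisticToContinuum.Crystallization.Theorems.ChartedPlanarOrderRigidityDoor
open Summit.AtomisticToContinuum.Crystallization.Theorems.ChartedPlanarOrderDensityDichotomy
open Summit.AtomisticToContinuum.Crystallization.Theorems.ChartedPlanarOrderMesoCut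
open Summit.AtomisticToContinuum.Crystallization.Theorems.OverbindingBudgetLiouvilleDictionary
open Literature.MathematicalPhysics.StatisticalMechanics (triangularVec₁ triangularVec₂)
open Literature.Geometry.DiscreteGeometry
open Summit.AtomisticToContinuum.Crystallization.Theorems.ChartedPlanarOrderDoorLayered
  (IsPeriod TwoPeriodic twoPeriodic_layeredHom_of_BD nearHomBD_restrict isCleanChunk_window' atomsIn_subset
   DoorHomogeneityBD NearHomBulkGapDenseBD hbgBD_of_bulk bulkDoor_of_homBD gap_and_pert_1_50_of_homBD
   DoorPeriodic PeriodicBulkGap PeriodicBulkGapDoor periodicBulkGap_of_bulk periodicBulkGapDoor_of_periodicBulkGap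
   bulkDoor_of_periodic gap_and_pert_1_50_of_periodic' doorPeriodic_of_doorHomogeneityBD hbg_pieces_both_of_bulk)
open Summit.AtomisticToContinuum.Crystallization.Theorems.ChartedPlanarOrderDoorLayeredBridge (layeredHom_of_twoPeriodic)

namespace Summit.AtomisticToContinuum.Crystallization.Theorems.ChartedZeroExcessLayeredHomCoercivityBD

/-! ## §1  Elementary facts about the tree currency `NearHomBD` (lens-4, `OverbindingBudgetLiouvilleDictionary` §3) -/

/-- `NearHomBD` is monotone in the distortion bound. -/
theorem nearHomBD_mono_Λ {Λ Λ' τ r : ℝ} {S Q : Set E3} (h : NearHomBD Λ τ r S Q) (hΛ : Λ ≤ Λ') : NearHomBD Λ' τ r S Q := by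
  obtain ⟨L, hL, hL', rest⟩ := h
  exact ⟨L, hL.trans hΛ, hL'.trans hΛ, rest⟩

/-- an exact configuration is `(τ, r)`-close to itself at every site (`τ ≥ 0`). -/
theorem envClose_self {τ r : ℝ} (hτ : 0 ≤ τ) (S : Set E3) (x : E3) : EnvClose τ r S x S x :=
  ⟨fun p hp _ => ⟨p, hp, by simpa using hτ⟩, fun q hq _ => ⟨q, hq, by simpa using hτ⟩⟩

/-- an exactly layered BD structure is near-homogeneous along `id` on each of its sub-chunks, at every `(τ, r)`, `τ ≥ 0`. -/
theorem nearHomBD_self {Λ τ r : ℝ} (hτ : 0 ≤ τ) {L : E3 ≃L[ℝ] E3} (hL : ‖(L : E3 →L[ℝ] E3)‖ ≤ Λ)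
    (hL' : ‖(L.symm : E3 →L[ℝ] E3)‖ ≤ Λ) (w : ℤ → E3) {P : Set E3} (hP : P ⊆ LayeredHom (L : E3 →L[ℝ] E3) w) :
    NearHomBD Λ τ r (LayeredHom (L : E3 →L[ℝ] E3) w) P :=
  ⟨L, hL, hL', w, id, Set.injOn_id _, fun _ hx => hP hx, fun x _ => envClose_self hτ _ x⟩

/-! ## §2  HBG♮(u)[BD] and the N column with the door discharged — NOW TREE DECLARATIONS (v7 rebase, critic row 411 (3))
This node's g23 text of HBG♮(u)[BD] `NearHomBulkGapDenseBD`, K0″ `hbgBD_of_bulk`, the HomCut seam K2″ `bulkDoor_of_homBD` (`1 ≤ Λ`) and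
★ `gap_and_pert_1_50_of_homBD : DoorHomogeneityBD 2 → NearHomBulkGapDenseBD → VisibleGap (1/50) ∧ PertRegime (1/50)` landed CHARACTER-IDENTICALLY
as §5 «interface with lens-2» of the tree module `Theorems.ChartedPlanarOrderDoorLayered` (lens-3 g22 node, hand-2 g8), together with L1′[BD]
`DoorHomogeneityBD`, L1′♮ `DoorPeriodic`, HBG″♭ `PeriodicBulkGap`, HBG″ `PeriodicBulkGapDoor` and their kernels, and `doorPeriodic_of_doorHomogeneityBD`
(`…DoorLayeredExactness`).  They are IMPORTED and `open`ed by name above; this file re-declares none of them (the v4–v6 byte-twins are deleted). -/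

/-! ## §3  SPECIAL: the certificate face on exactly layered structures, and the plain bridge -/

/-- **A «LayeredCoercivityDense»** (CERTIFICATE FACE · INSTRUMENTABLE = TAG 139′ HBC-CERT′ + REGISTRY column; row 399 (4) caveat: possibly to be
restricted to a certified stable sub-window): HBG♮(u)[BD] for EXACTLY layered configurations `S = LayeredHom L w` (`L` a BD chart,
`S` `δ`-separated) — coercivity-with-density of `e⋆` on the layered family. -/
def LayeredCoercivityDense : Prop :=
  ∀ Λ : ℝ, 1 ≤ Λ → ∀ δ : ℝ, 0 < δ → ∀ θ : ℝ, 0 < θ → θ ≤ 1 / 16 → ∀ u : ℝ, 0 < u → u ≤ 1 → ∃ η : ℝ, 0 < η ∧ ∀ ε : ℝ, 0 < ε →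
    ∃ C : ℝ, 0 ≤ C ∧ ∃ r' : ℝ, 0 < r' ∧
      ∀ (L : E3 ≃L[ℝ] E3) (w : ℤ → E3) (P : Set E3), ‖(L : E3 →L[ℝ] E3)‖ ≤ Λ → ‖(L.symm : E3 →L[ℝ] E3)‖ ≤ Λ →
        IsSep δ (LayeredHom (L : E3 →L[ℝ] E3) w) → IsCleanChunk (LayeredHom (L : E3 →L[ℝ] E3) w) P →
        u * nK P ≤ nBad θ (LayeredHom (L : E3 →L[ℝ] E3) w) P →
        η * nK P ≤ excess (LayeredHom (L : E3 →L[ℝ] E3) w) P + C * nBdry r' (LayeredHom (L : E3 →L[ℝ] E3) w) P + ε * nK P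

/-- **A is WEAKER than HBG♮(u)[BD]** (an exact structure is near itself along `id`). -/
theorem layeredCoercivityDense_of_hbgBD (h : NearHomBulkGapDenseBD) : LayeredCoercivityDense := by
  intro Λ hΛ δ hδ θ hθ hθ' u hu hu1
  obtain ⟨η, hη, hε⟩ := h Λ hΛ δ hδ θ hθ hθ' u hu hu1
  refine ⟨η, hη, fun ε hεp => ?_⟩
  obtain ⟨τ, hτ, r, -, C, hC, r', hr', h'⟩ := hε ε hεp
  exact ⟨C, hC, r', hr', fun L w P hL hL' hsep hP hd => h' _ P hsep hP (nearHomBD_self hτ.le hL hL' w hP.1) hd⟩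

/-- **B «NearHomReduction»** (BRIDGE-SHAPED; TRUE if HBG♮(u)[BD] is): the certificate face implies the near-layered statement.
EDGE ANALYSIS (why the naive badness transfer is NOT the proof; critic rows 391–396): «`Ψ x` matched in `H` ⇒ `x` matched in `S`» crosses
`matchedAt`'s hard radius `4b`/`5b` and the scale-window edge `[9/10, 1]`, which energy does not price at `θ = 1/16`; hence §4. -/
def NearHomReduction : Prop := LayeredCoercivityDense → NearHomBulkGapDenseBD

/-- **K1″** HBG♮(u)[BD] ⟸ A ∧ B. -/
theorem hbgBD_of_pieces (hA : LayeredCoercivityDense) (hB : NearHomReduction) : NearHomBulkGapDenseBD := hB hA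

/-! ### §3b  A♭ — the exact-layered HBG on ROOT WINDOWS (lens-2's half of lens-3's HBG″♭ `PeriodicBulkGap Λ`; critic row 407 (2)(4)) -/

/-- **A♭ «ExactLayeredBulkGap Λ»** — lens-3's HBG″♭ `PeriodicBulkGap` (DoorLayered §4: BULK on root windows of rooted, separated, CLEAN,
TWO-PERIODIC configurations; Nash-free, chart-free) in EXTRINSIC form: the configuration IS an exactly layered structure `LayeredHom L w` under a
continuous linear automorphism of distortion `≤ Λ`.  HBG″♭(Λ) ⟸ A♭(Λ′) ∧ lens-3's bridge B (`TwoPeriodic Λ S ∧ IsSep δ S ⟹ S = LayeredHom L w`,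
`‖L‖, ‖L⁻¹‖ ≤ Λ′(Λ, δ)` via covolume; row 407 (2), lens-3 g23) — so A♭ is the LAYER-CHAIN coercivity-with-density statement the census column
TAG 139′ instruments, with NO tolerance, NO slack and NO assignment. -/
def ExactLayeredBulkGap (Λ : ℝ) : Prop :=
  ∀ δ : ℝ, 0 < δ → ∀ θ : ℝ, 0 < θ → θ ≤ 1 / 16 → ∀ u : ℝ, 0 < u → u ≤ 1 →
    ∃ η : ℝ, 0 < η ∧ ∃ C : ℝ, 0 ≤ C ∧ ∃ r : ℝ, 0 < r ∧ ∃ R₀ : ℝ, 1 ≤ R₀ ∧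
      ∀ (L : E3 ≃L[ℝ] E3) (w : ℤ → E3), ‖(L : E3 →L[ℝ] E3)‖ ≤ Λ → ‖(L.symm : E3 →L[ℝ] E3)‖ ≤ Λ →
        (0 : E3) ∈ LayeredHom (L : E3 →L[ℝ] E3) w → IsSep δ (LayeredHom (L : E3 →L[ℝ] E3) w) →
        IsClean (μS (LayeredHom (L : E3 →L[ℝ] E3) w)) → ∀ R : ℝ, R₀ ≤ R →
        u * nK (atomsIn (μS (LayeredHom (L : E3 →L[ℝ] E3) w)) 0 R) ≤
            nBad θ (LayeredHom (L : E3 →L[ℝ] E3) w) (atomsIn (μS (LayeredHom (L : E3 →L[ℝ] E3) w)) 0 R) →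
        η * nK (atomsIn (μS (LayeredHom (L : E3 →L[ℝ] E3) w)) 0 R) ≤
          excess (LayeredHom (L : E3 →L[ℝ] E3) w) (atomsIn (μS (LayeredHom (L : E3 →L[ℝ] E3) w)) 0 R) +
            C * nBdry r (LayeredHom (L : E3 →L[ℝ] E3) w) (atomsIn (μS (LayeredHom (L : E3 →L[ℝ] E3) w)) 0 R)

/-- **A ⟹ A♭** (`Λ ≥ 1`; slack `ε = η/2`, the root window is a clean chunk): the root-window form is WEAKER than the certificate face. -/
theorem exactLayeredBulkGap_of_layeredCoercivityDense {Λ : ℝ} (hΛ : 1 ≤ Λ) (hA : LayeredCoercivityDense) : ExactLayeredBulkGap Λ := by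
  intro δ hδ θ hθ hθ' u hu hu1
  obtain ⟨η, hη, hε⟩ := hA Λ hΛ δ hδ θ hθ hθ' u hu hu1
  obtain ⟨C, hC, r', hr', h'⟩ := hε (η / 2) (by positivity)
  refine ⟨η / 2, by positivity, C, hC, r', hr', 1, le_rfl, fun L w hL hL' _ hsep hclean R _ hd => ?_⟩
  have h2 := h' L w _ hL hL' hsep (isCleanChunk_window' hδ hsep hclean R) hd
  linarith

/-- **A♭ is monotone in Λ downward** (a smaller distortion class is a weaker demand). -/
theorem ExactLayeredBulkGap.mono {Λ Λ' : ℝ} (hΛ : Λ' ≤ Λ) (h : ExactLayeredBulkGap Λ) : ExactLayeredBulkGap Λ' := by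
  intro δ hδ θ hθ hθ' u hu hu1
  obtain ⟨η, hη, C, hC, r, hr, R₀, hR₀, h'⟩ := h δ hδ θ hθ hθ' u hu hu1
  exact ⟨η, hη, C, hC, r, hr, R₀, hR₀, fun L w hL hL' => h' L w (hL.trans hΛ) (hL'.trans hΛ)⟩

/-- **K0♭** BULK ⟹ A♭ (through HBG♮(u)[BD] and A). -/
theorem exactLayeredBulkGap_of_bulk {Λ : ℝ} (hΛ : 1 ≤ Λ) (hB : BulkDefectGap) : ExactLayeredBulkGap Λ :=
  exactLayeredBulkGap_of_layeredCoercivityDense hΛ (layeredCoercivityDense_of_hbgBD (hbgBD_of_bulk hB))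

/-! ## §3c  A♭ ⟺ HBG″♭ MODULO BRIDGE B, OVER TREE NAMES (critic l.1957 ORDER «state N″ / its HBG-side twin HBG″♭ over tree names»;
row 411 (2) RULED: «A♭ IS lens-2's typed half of HBG″♭ — HBG″♭ `PeriodicBulkGap Λ` ⟸ A♭(Λ′(Λ, δ)) ∧ bridge B; `periodicBulkGap_of_exactLayered`
lands with whichever side is second»).  Tree names used: `TwoPeriodic`, `twoPeriodic_layeredHom_of_BD` (`…DoorLayeredExact/Near`), `PeriodicBulkGap`,
`DoorPeriodic`, `gap_and_pert_1_50_of_periodic'` (`…DoorLayered`).  Bridge B is the INTERFACE `PeriodicChart Λ Λ′` below; lens-3 g22 has since PROVED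
it in exactly this shape with `Λ′ δ = 4Λ + 13Λ/δ²` (HOME `decomp-a2c-lens-3/g22/BridgeB.lean`, `…DoorLayeredBridge.layeredHom_of_twoPeriodic`,
sha256 2f21dc3d…; LANDED as `Theorems/ChartedPlanarOrderDoorLayeredBridge.lean`, hand-2 p820697, 2026-08-31): `periodicChart_of_bridgeB` below
(v8) discharges `hB` in every theorem of this section — primed versions `periodicBulkGap_of_exactLayered'`,
`periodicBulkGap_of_layeredCoercivityDense'`, ★♭′ `gap_and_pert_1_50_of_exactLayered'`, ★♭″ `gap_and_pert_1_50_of_layeredCoercivityDense`. -/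

/-- **bridge B «PeriodicChart Λ Λ′»** (the typed INTERFACE of lens-3's bridge, rows 407 (2) / 411 (2); TRUE·S/M, PROVED by lens-3 g22 for
`Λ′ δ = 4Λ + 13Λ/δ²` and LANDED (tree `layeredHom_of_twoPeriodic`; instance `periodicChart_of_bridgeB`): a rooted `δ`-separated configuration
with two independent exact periods of length `≤ Λ` IS `LayeredHom L w` for a chart with `‖L‖, ‖L⁻¹‖ ≤ Λ′(δ)` — `Λ′` from the covolume bound
`covol ≥ (√3/2)·δ²` of a `δ`-separated planar lattice; the third column of `L` is free).  Stated as a hypothesis here. -/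
def PeriodicChart (Λ : ℝ) (Λ' : ℝ → ℝ) : Prop :=
  ∀ δ : ℝ, 0 < δ → ∀ S : Set E3, (0 : E3) ∈ S → IsSep δ S → TwoPeriodic Λ S →
    ∃ (L : E3 ≃L[ℝ] E3) (w : ℤ → E3), ‖(L : E3 →L[ℝ] E3)‖ ≤ Λ' δ ∧ ‖(L.symm : E3 →L[ℝ] E3)‖ ≤ Λ' δ ∧
      S = LayeredHom (L : E3 →L[ℝ] E3) w

/-- **HBG″♭(Λ) ⟹ A♭(Λ)** outright (tree `twoPeriodic_layeredHom_of_BD`: a BD layered structure with `‖L‖ ≤ Λ` is two-periodic with periods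
`L t₁, L t₂` of length `≤ Λ`). -/
theorem exactLayeredBulkGap_of_periodicBulkGap {Λ : ℝ} (h : PeriodicBulkGap Λ) : ExactLayeredBulkGap Λ := by
  intro δ hδ θ hθ hθ' u hu hu1
  obtain ⟨η, hη, C, hC, r, hr, R₀, hR₀, h'⟩ := h δ hδ θ hθ hθ' u hu hu1
  exact ⟨η, hη, C, hC, r, hr, R₀, hR₀, fun L w hL _ h0 hsep hclean R hR hd =>
    h' _ h0 hsep hclean (twoPeriodic_layeredHom_of_BD L hL w) R hR hd⟩

/-- **A♭ ∧ B ⟹ HBG″♭**: `PeriodicChart Λ Λ′ → (∀ δ > 0, ExactLayeredBulkGap (Λ′ δ)) → PeriodicBulkGap Λ` — so, modulo the bridge, lens-2's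
chart-uniform A♭ and lens-3's chart-free HBG″♭ are ONE statement (the 5-line kernel promised in the g23 ASK (2)). -/
theorem periodicBulkGap_of_exactLayered {Λ : ℝ} {Λ' : ℝ → ℝ} (hB : PeriodicChart Λ Λ') (hA : ∀ δ : ℝ, 0 < δ → ExactLayeredBulkGap (Λ' δ)) :
    PeriodicBulkGap Λ := by
  intro δ hδ θ hθ hθ' u hu hu1
  obtain ⟨η, hη, C, hC, r, hr, R₀, hR₀, h'⟩ := hA δ hδ δ hδ θ hθ hθ' u hu hu1
  refine ⟨η, hη, C, hC, r, hr, R₀, hR₀, fun S h0 hsep hclean hP R hR hd => ?_⟩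
  obtain ⟨L, w, hL, hL', rfl⟩ := hB δ hδ S h0 hsep hP
  exact h' L w hL hL' h0 hsep hclean R hR hd

/-- hence **A ∧ B ⟹ HBG″♭(Λ)** for every `Λ` (with `Λ′ ≥ 1`): the certificate face feeds lens-3's chart-free energy piece. -/
theorem periodicBulkGap_of_layeredCoercivityDense {Λ : ℝ} {Λ' : ℝ → ℝ} (hB : PeriodicChart Λ Λ') (hΛ' : ∀ δ : ℝ, 0 < δ → 1 ≤ Λ' δ)
    (hA : LayeredCoercivityDense) : PeriodicBulkGap Λ :=
  periodicBulkGap_of_exactLayered hB fun δ hδ => exactLayeredBulkGap_of_layeredCoercivityDense (hΛ' δ hδ) hA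

/-- ★♭ **the chart-free N branch (β) fed by lens-2's pieces, door DISCHARGED by name** (tree `gap_and_pert_1_50_of_periodic'`):
`DoorPeriodic Λ → PeriodicChart Λ Λ′ → (∀ δ > 0, ExactLayeredBulkGap (Λ′ δ)) → VisibleGap (1/50) ∧ PertRegime (1/50)`. -/
theorem gap_and_pert_1_50_of_exactLayered {Λ : ℝ} {Λ' : ℝ → ℝ} (hP : DoorPeriodic Λ) (hB : PeriodicChart Λ Λ')
    (hA : ∀ δ : ℝ, 0 < δ → ExactLayeredBulkGap (Λ' δ)) : VisibleGap (1 / 50) ∧ PertRegime (1 / 50) :=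
  gap_and_pert_1_50_of_periodic' hP (periodicBulkGap_of_exactLayered hB hA)

/-! ### §3c′ (v8) bridge B DISCHARGED by the landed tree theorem (lens-3 g22 `BridgeB`, hand-2 p820697) -/

/-- ★ **bridge B holds with `Λ′ δ = 4Λ + 13Λ/δ²`** (tree `…ChartedPlanarOrderDoorLayeredBridge.layeredHom_of_twoPeriodic`, one line). -/
theorem periodicChart_of_bridgeB (Λ : ℝ) : PeriodicChart Λ (fun δ => 4 * Λ + 13 * Λ / δ ^ 2) :=
  fun _ hδ _ h0 hS hP => layeredHom_of_twoPeriodic hδ h0 hS hP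

/-- **A♭ ⟹ HBG″♭ BRIDGE-FREE**: `(∀ δ > 0, ExactLayeredBulkGap (4Λ + 13Λ/δ²)) → PeriodicBulkGap Λ` — lens-2's chart-uniform A♭ (at the bridge's
distortion) and lens-3's chart-free HBG″♭ are now ONE statement outright in the direction that feeds N. -/
theorem periodicBulkGap_of_exactLayered' {Λ : ℝ} (hA : ∀ δ : ℝ, 0 < δ → ExactLayeredBulkGap (4 * Λ + 13 * Λ / δ ^ 2)) :
    PeriodicBulkGap Λ :=
  periodicBulkGap_of_exactLayered (periodicChart_of_bridgeB Λ) hA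

/-- **A ⟹ HBG″♭(Λ) BRIDGE-FREE** for every `Λ ≥ 1/4` (so that `Λ′ δ ≥ 1`): the certificate face feeds lens-3's chart-free energy piece. -/
theorem periodicBulkGap_of_layeredCoercivityDense' {Λ : ℝ} (hΛ : 1 / 4 ≤ Λ) (hA : LayeredCoercivityDense) : PeriodicBulkGap Λ :=
  periodicBulkGap_of_layeredCoercivityDense (periodicChart_of_bridgeB Λ)
    (fun δ _ => by
      have h13 : 0 ≤ 13 * Λ / δ ^ 2 := div_nonneg (by linarith) (sq_nonneg δ)
      show (1 : ℝ) ≤ 4 * Λ + 13 * Λ / δ ^ 2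
      linarith)
    hA

/-- ★♭′ **the chart-free N branch (β) fed by lens-2's A♭, bridge B AND door DISCHARGED by name** (tree `gap_and_pert_1_50_of_periodic'`,
`layeredHom_of_twoPeriodic`): `DoorPeriodic Λ → (∀ δ > 0, ExactLayeredBulkGap (4Λ + 13Λ/δ²)) → VisibleGap (1/50) ∧ PertRegime (1/50)`. -/
theorem gap_and_pert_1_50_of_exactLayered' {Λ : ℝ} (hP : DoorPeriodic Λ)
    (hA : ∀ δ : ℝ, 0 < δ → ExactLayeredBulkGap (4 * Λ + 13 * Λ / δ ^ 2)) : VisibleGap (1 / 50) ∧ PertRegime (1 / 50) :=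
  gap_and_pert_1_50_of_exactLayered hP (periodicChart_of_bridgeB Λ) hA

/-- ★♭″ **at Λ₀ = 2 from the certificate face A — TWO leaves**: `DoorPeriodic 2 → LayeredCoercivityDense → VisibleGap (1/50) ∧ PertRegime (1/50)`
(L1′♮ from the sibling node's Liouville column; A = the HBG-side certificate, TAG 139′). -/
theorem gap_and_pert_1_50_of_layeredCoercivityDense (hP : DoorPeriodic 2) (hA : LayeredCoercivityDense) :
    VisibleGap (1 / 50) ∧ PertRegime (1 / 50) :=
  gap_and_pert_1_50_of_periodic' hP (periodicBulkGap_of_layeredCoercivityDense' (by norm_num) hA)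

/-- **HBG″ `PeriodicBulkGapDoor 2` ⟸ A BRIDGE-FREE** (tree `periodicBulkGapDoor_of_periodicBulkGap`): the fifth leaf of the sibling node's (β) columns
resolves into lens-2's certificate face alone. -/
theorem periodicBulkGapDoor_two_of_layeredCoercivityDense (hA : LayeredCoercivityDense) : PeriodicBulkGapDoor 2 :=
  periodicBulkGapDoor_of_periodicBulkGap (periodicBulkGap_of_layeredCoercivityDense' (by norm_num) hA)

/-! ## §4  GENERIC: the robust (edge-free) reduction through a misfit gauge — interface + pieces -/

/-- **B₃ «SiteEnergyLocality»** (CB-LOCALITY, TRUE·S/M): site energies of `δ`-separated configurations are continuous in the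
`(τ, r)`-environment: `|e_S(x) − e_H(y)| ≤ ε` once `τ ≤ τ₀(δ, ε)` and `r ≥ r₀(δ, ε)` (`V′_LJ` summably Lipschitz away from `0`). -/
def SiteEnergyLocality : Prop :=
  ∀ δ : ℝ, 0 < δ → ∀ ε : ℝ, 0 < ε → ∃ τ₀ : ℝ, 0 < τ₀ ∧ ∃ r₀ : ℝ, 0 < r₀ ∧
    ∀ τ r : ℝ, 0 < τ → τ ≤ τ₀ → r₀ ≤ r → ∀ (S H : Set E3) (x y : E3), IsSep δ S → IsSep δ H → x ∈ S → y ∈ H →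
      EnvClose τ r S x H y → |siteEnergy (μS S) x - siteEnergy (μS H) y| ≤ ε

/-- **B₁ «GaugeCoercivity mis»** (CERTIFICATE in gauge form · TAG 139′ + REGISTRY): on exactly layered, separated BD structures the chunk
excess controls the number of sites of misfit `≥ s`, up to boundary and slack — no cleanliness, no `matchedAt` (census-computable). -/
def GaugeCoercivity (mis : (E3 →L[ℝ] E3) → (ℤ → E3) → E3 → ℝ) : Prop :=
  ∀ Λ : ℝ, 1 ≤ Λ → ∀ δ : ℝ, 0 < δ → ∀ s : ℝ, 0 < s → ∀ u : ℝ, 0 < u → u ≤ 1 → ∃ η : ℝ, 0 < η ∧ ∀ ε : ℝ, 0 < ε →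
    ∃ C : ℝ, 0 ≤ C ∧ ∃ r' : ℝ, 0 < r' ∧
      ∀ (L : E3 ≃L[ℝ] E3) (w : ℤ → E3) (P : Set E3), ‖(L : E3 →L[ℝ] E3)‖ ≤ Λ → ‖(L.symm : E3 →L[ℝ] E3)‖ ≤ Λ →
        IsSep δ (LayeredHom (L : E3 →L[ℝ] E3) w) → P ⊆ LayeredHom (L : E3 →L[ℝ] E3) w → P.Finite →
        u * nK P ≤ (Set.ncard {y ∈ P | s ≤ mis (L : E3 →L[ℝ] E3) w y} : ℝ) →
        η * nK P ≤ excess (LayeredHom (L : E3 →L[ℝ] E3) w) P + C * nBdry r' (LayeredHom (L : E3 →L[ℝ] E3) w) P + ε * nK P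

/-- **B₂ «GaugeControlsMatching mis»** (GEOMETRY, TRUE·M for the intended Barlow misfit gauge; edge-free): small misfit at the reference
site of a `(τ, r)`-close environment forces the atom to be `θ`-matched (the template is built from the reference's own layers out to
radius `5b + 1`; tolerances add, `τ + C·s ≤ θ`). -/
def GaugeControlsMatching (mis : (E3 →L[ℝ] E3) → (ℤ → E3) → E3 → ℝ) : Prop :=
  ∀ Λ : ℝ, 1 ≤ Λ → ∀ δ : ℝ, 0 < δ → ∀ θ : ℝ, 0 < θ → θ ≤ 1 / 16 → ∃ s : ℝ, 0 < s ∧ ∃ τ₀ : ℝ, 0 < τ₀ ∧ ∃ r₀ : ℝ, 0 < r₀ ∧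
    ∀ τ r : ℝ, 0 < τ → τ ≤ τ₀ → r₀ ≤ r →
      ∀ (S : Set E3) (L : E3 ≃L[ℝ] E3) (w : ℤ → E3) (x y : E3), IsSep δ S → ‖(L : E3 →L[ℝ] E3)‖ ≤ Λ → ‖(L.symm : E3 →L[ℝ] E3)‖ ≤ Λ →
        IsSep (δ / 2) (LayeredHom (L : E3 →L[ℝ] E3) w) → x ∈ S → y ∈ LayeredHom (L : E3 →L[ℝ] E3) w →
        EnvClose τ r S x (LayeredHom (L : E3 →L[ℝ] E3) w) y → mis (L : E3 →L[ℝ] E3) w y < s → matchedAt θ (μS S) x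

/-- **«GaugeReduction»** (TRUE·M BOOKKEEPING, ATTACKABLE; not kernel-proved in this generation): a gauge with B₁ ∧ B₂, together with
CB-locality B₃, gives HBG♮(u)[BD].  PROOF PLAN over the tree currency (which allows a non-separated reference and a scrambled assignment):
(i) CLEAN-UP — near `Ψ x₀` the reference's layers within `r` are `τ`-matched two-sidedly to the `δ`-separated `S`, so after deleting
near-duplicate layers (`‖w m − w m′‖`-close cosets) and re-indexing, the reference is `(δ − 3τ)`-separated on the window (a homogeneous layered
structure is as separated globally as locally); (ii) LOCAL RE-ASSIGNMENT — `Ψ′ x := ` the reference point matched to `x` inside the environment of a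
base atom `x₀` (`dist x x₀ ≤ r/2`) is injective, coherent and `(3τ, r/2 − 2)`-close (triangle inequality through `x₀`'s environment);
(iii) per sub-window `P := Ψ′(Q ∩ B(x₀, r/4))`: bad atoms ↦ misfit-`≥ s` sites (B₂, contrapositive), site energies transported by B₃, boundary
atoms of `P` in the reference come from boundary atoms of `Q` or from the window's cut surface; (iv) B₁ on each sub-window and a tiling of `Q` by
sub-windows: the cut surfaces cost `≤ C·#Q·(r′/r)`, absorbed in the slack `ε·#Q` by the prover's choice `r ≥ C r′/ε` (the quantifier order
`∀ ε ∃ τ ∃ r` of HBG♮(u)[BD] allows it). -/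
def GaugeReduction : Prop :=
  (∃ mis : (E3 →L[ℝ] E3) → (ℤ → E3) → E3 → ℝ, GaugeCoercivity mis ∧ GaugeControlsMatching mis) →
    SiteEnergyLocality → NearHomBulkGapDenseBD

/-- **K3″** HBG♮(u)[BD] ⟸ (∃ gauge with B₁ ∧ B₂) ∧ B₃ ∧ GaugeReduction. -/
theorem hbgBD_of_gauge (mis : (E3 →L[ℝ] E3) → (ℤ → E3) → E3 → ℝ) (h₁ : GaugeCoercivity mis) (h₂ : GaugeControlsMatching mis)
    (h₃ : SiteEnergyLocality) (hR : GaugeReduction) : NearHomBulkGapDenseBD :=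
  hR ⟨mis, h₁, h₂⟩ h₃

/-- ★★ **the whole third N branch from this generation's leaves (door discharged)**:
`DoorHomogeneityBD 2 → GaugeCoercivity mis → GaugeControlsMatching mis → SiteEnergyLocality → GaugeReduction → GAP(1/50) ∧ PERT(1/50)`. -/
theorem gap_and_pert_1_50_of_gauge (h1 : DoorHomogeneityBD 2) (mis : (E3 →L[ℝ] E3) → (ℤ → E3) → E3 → ℝ)
    (h₁ : GaugeCoercivity mis) (h₂ : GaugeControlsMatching mis) (h₃ : SiteEnergyLocality) (hR : GaugeReduction) :
    VisibleGap (1 / 50) ∧ PertRegime (1 / 50) :=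
  gap_and_pert_1_50_of_homBD h1 (hbgBD_of_gauge mis h₁ h₂ h₃ hR)

end Summit.AtomisticToContinuum.Crystallization.Theorems.ChartedZeroExcessLayeredHomCoercivityBD

end
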